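import Mathlib
import Summits.ValiantsHypothesis.ValiantsHypothesis.Theorems.FifoMatchingNNLinearDegreeCofactorHardQueueGenerations
import HarnessLib

/-!
# Crux `NNLinearDegreeCofactorHard` (stmt-ValiantsHypothesis-23918), line `internal_cofactor`: the GROWTH BOUND of one
# generation (unit U3 of the (D*) architecture — the heart of the transfer-cost lemma for μ* = shedWord)

Abstract queue history (`…NNMonotoneHardBoundaries`, `…QueueGenealogy`, `…QueueGenerations`) with an item LINEAGE flag
`isR : ℕ → Bool` (R-items; the others are S-items).  Fix a colour `b`.  Over one generation `[T, G)`, `G = gen c rO T`: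

* the S-items of colour `b` alive at `G` are the `b`-coloured S-pushes of `[T, G)` (`card_aliveS_gen_eq`);
* a `b`-coloured S-push is a TEST (its time disagrees with the front) or copies a `b`-coloured front (`card_bPush_le`);
* on a stretch where the front colour is constant `= b`, S-pushes ≤ S-pops + `C·√#fair` (hypothesis REG, one window), and
  S-pops with a `b`-front pop distinct alive `b`-S-items (`card_bPop_le_aliveS`); the front colour changes only at boundary
  arrivals, at most `#boundaries inside alive(T)` times (`card_changes_le_boundaries`), and summing the stretch bounds by
  induction on the LAST change time with `√((n+1)a) + √b ≤ √((n+2)(a+b))` (`stretch_sum_le`) gives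

  `growth_le`:  `Z_b(G) ≤ Z_b(T) + tests[T,G) + C·√((#boundaries + 1)·#fair[T,G))`.

Hypothesis NS («an S-push happens only on an S-front») is what makes R-items sterile.  Deterministic; nothing here proves
S2b, the crux or VP ≠ VNP (not proved). [folklore]
-/

-- Sub = Summit single-conjunct layout: the duplicated namespace component is mandated by the tree.
set_option linter.dupNamespace false

namespace Summit.ValiantsHypothesis.ValiantsHypothesis.Theorems.FifoMatching.NNLinearDegreeCofactorHard.QueueHistory

open Finset Real
open Summit.ValiantsHypothesis.ValiantsHypothesis.Theorems.FifoMatching.NNMonotoneHard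

/-! ### The counted objects -/

/-- S-pushes in `[u, v)` (pushes creating a non-R item). [folklore] -/
def sPush (W : ℕ → Bool) (rO : ℕ → ℕ) (isR : ℕ → Bool) (u v : ℕ) : ℕ :=
  ((Ico u v).filter fun t => W t = true ∧ isR (rO t) = false).card

/-- S-pops in `[u, v)` (pops removing a non-R front). [folklore] -/
def sPop (W : ℕ → Bool) (rC : ℕ → ℕ) (isR : ℕ → Bool) (u v : ℕ) : ℕ :=
  ((Ico u v).filter fun t => W t = false ∧ isR (rC t) = false).card

/-- S-pushes in `[u, v)` whose FRONT has colour `b`. [folklore] -/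
def bPush (W σ : ℕ → Bool) (rO rC o : ℕ → ℕ) (isR : ℕ → Bool) (b : Bool) (u v : ℕ) : ℕ :=
  ((Ico u v).filter fun t => W t = true ∧ isR (rO t) = false ∧ σ (o (rC t)) = b).card

/-- S-pops in `[u, v)` whose front has colour `b`. [folklore] -/
def bPop (W σ : ℕ → Bool) (rC o : ℕ → ℕ) (isR : ℕ → Bool) (b : Bool) (u v : ℕ) : ℕ :=
  ((Ico u v).filter fun t => W t = false ∧ isR (rC t) = false ∧ σ (o (rC t)) = b).card

/-- TESTS in `[u, v)`: S-pushes whose time disagrees in colour with the front. [folklore] -/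
def sTests (W σ : ℕ → Bool) (rO rC o : ℕ → ℕ) (isR : ℕ → Bool) (u v : ℕ) : ℕ :=
  ((Ico u v).filter fun t => W t = true ∧ isR (rO t) = false ∧ σ t ≠ σ (o (rC t))).card

/-- Front-colour CHANGE times strictly inside `(u, v)`. [folklore] -/
def changes (σ : ℕ → Bool) (rC o : ℕ → ℕ) (u v : ℕ) : ℕ :=
  ((Ioo u v).filter fun s => σ (o (rC s)) ≠ σ (o (rC (s - 1)))).card

/-- Alive S-items of colour `b` at time `T`. [folklore] -/
def aliveS (σ : ℕ → Bool) (rO rC o : ℕ → ℕ) (isR : ℕ → Bool) (b : Bool) (T : ℕ) : ℕ :=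
  ((Ico (rC T) (rO T)).filter fun k => isR k = false ∧ σ (o k) = b).card

section AbstractQueue

variable {W σ : ℕ → Bool} {rO rC o c : ℕ → ℕ} {n' : ℕ} {isR : ℕ → Bool}
variable (hOs : ∀ t, rO (t + 1) = rO t + (if W t = true then 1 else 0))
  (hCs : ∀ t, rC (t + 1) = rC t + (if W t = true then 0 else 1))
  (ho : ∀ k t, k < n' → (o k < t ↔ k < rO t))
  (hc : ∀ k t, k < n' → (c k < t ↔ k < rC t))

/-! ### Interval additivity -/

/-- Splitting a filtered `Ico`-count at an intermediate point. [folklore] -/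
theorem card_filter_Ico_add (P : ℕ → Prop) [DecidablePred P] {u d v : ℕ} (hud : u ≤ d) (hdv : d ≤ v) :
    ((Ico u v).filter P).card = ((Ico u d).filter P).card + ((Ico d v).filter P).card := by
  rw [← card_union_of_disjoint]
  · congr 1
    rw [← filter_union, Ico_union_Ico_eq_Ico hud hdv]
  · exact disjoint_filter_filter (Ico_disjoint_Ico_consecutive u d v)

/-! ### The alive `b`-S-items after a generation are its `b`-coloured S-pushes -/

include hOs hCs ho hc in
/-- **`Z_b(gen T)` counts the `b`-coloured S-pushes of `[T, gen T)`.** [folklore] -/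
theorem card_aliveS_gen_eq (b : Bool) {T : ℕ} (hne : rC T < rO T) (hnT : rO T ≤ n') (hnG : rO (gen c rO T) ≤ n') :
    aliveS σ rO rC o isR b (gen c rO T) =
      ((Ico T (gen c rO T)).filter fun t => W t = true ∧ isR (rO t) = false ∧ σ (o (rO t)) = b).card := by
  classical
  set G := gen c rO T with hG
  unfold aliveS
  rw [rankC_gen hCs hc hne hnT]
  -- push times `t ∈ [T, G)` ↦ items `rO t ∈ [rO T, rO G)`
  have hlt : ∀ t, t < G → W t = true → rO t < n' := fun t ht hW => by
    have h1 : rO (t + 1) ≤ rO G := rankO_mono hOs (Nat.succ_le_of_lt ht)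
    rw [hOs, if_pos hW] at h1; omega
  symm
  rw [← card_image_of_injOn (f := rO)]
  · congr 1
    ext k
    simp only [mem_image, mem_filter, mem_Ico]
    constructor
    · rintro ⟨t, ⟨⟨hTt, htG⟩, hW, hR, hb⟩, rfl⟩
      refine ⟨⟨rankO_mono hOs hTt, ?_⟩, hR, hb⟩
      have h1 : rO (t + 1) ≤ rO G := rankO_mono hOs (Nat.succ_le_of_lt htG)
      rw [hOs, if_pos hW] at h1; omega
    · rintro ⟨⟨hk1, hk2⟩, hR, hb⟩
      have hk : k < n' := lt_of_lt_of_le hk2 hnG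
      obtain ⟨hrank, hW⟩ := rankO_opener hOs ho hk
      refine ⟨o k, ⟨⟨?_, (ho k G hk).2 hk2⟩, hW, by rw [hrank]; exact hR, by rw [hrank]; exact hb⟩, hrank⟩
      by_contra hlt'
      push Not at hlt'
      have := (ho k T hk).1 hlt'; omega
  · intro t₁ h₁ t₂ h₂ heq
    have h₁' := (mem_filter.1 (mem_coe.1 h₁)); have h₂' := (mem_filter.1 (mem_coe.1 h₂))
    have e₁ := opener_at hOs ho h₁'.2.1 (hlt t₁ (mem_Ico.1 h₁'.1).2 h₁'.2.1)
    have e₂ := opener_at hOs ho h₂'.2.1 (hlt t₂ (mem_Ico.1 h₂'.1).2 h₂'.2.1)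
    rw [← e₁, ← e₂, heq]

/-! ### `b`-coloured S-pushes: tests, or copies of a `b`-front -/

include hOs ho in
/-- **A `b`-coloured S-push is a test or copies a `b`-coloured front.** [folklore] -/
theorem card_bPush_le (b : Bool) {T G : ℕ} (hn : ∀ t, T ≤ t → t < G → W t = true → rO t < n') :
    ((Ico T G).filter fun t => W t = true ∧ isR (rO t) = false ∧ σ (o (rO t)) = b).card ≤
      sTests W σ rO rC o isR T G + bPush W σ rO rC o isR b T G := by
  classical
  unfold sTests bPush
  refine (card_le_card fun t ht => ?_).trans (card_union_le _ _)
  rw [mem_filter] at ht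
  obtain ⟨hI, hW, hR, hb⟩ := ht
  have htn := hn t (mem_Ico.1 hI).1 (mem_Ico.1 hI).2 hW
  rw [colour_push (σ := σ) hOs ho hW htn] at hb
  rw [mem_union, mem_filter, mem_filter]
  by_cases hagree : σ t = σ (o (rC t))
  · exact Or.inr ⟨hI, hW, hR, by rw [← hagree]; exact hb⟩
  · exact Or.inl ⟨hI, hW, hR, hagree⟩

/-! ### `b`-front S-pops pop distinct alive `b`-S-items -/

include hCs hc in
/-- **S-pops with a `b`-coloured front during `[T, gen T)` number at most the `b`-S-items alive at `T`.** [folklore] -/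
theorem card_bPop_le_aliveS (b : Bool) {T : ℕ} (hne : rC T < rO T) (hnT : rO T ≤ n') :
    bPop W σ rC o isR b T (gen c rO T) ≤ aliveS σ rO rC o isR b T := by
  classical
  unfold bPop aliveS
  rw [← card_image_of_injOn (f := rC)]
  · refine card_le_card fun k hk => ?_
    rw [mem_image] at hk
    obtain ⟨t, ht, rfl⟩ := hk
    rw [mem_filter, mem_Ico] at ht ⊢
    obtain ⟨⟨hTt, htG⟩, hW, hR, hb⟩ := ht
    exact ⟨rankC_mem_of_lt_gen hCs hc hne hnT hTt htG, hR, hb⟩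
  · intro t₁ h₁ t₂ h₂ heq
    have h₁' := mem_filter.1 (mem_coe.1 h₁); have h₂' := mem_filter.1 (mem_coe.1 h₂)
    have hk₁ : rC t₁ < n' := lt_of_lt_of_le (rankC_mem_of_lt_gen hCs hc hne hnT (mem_Ico.1 h₁'.1).1 (mem_Ico.1 h₁'.1).2).2 hnT
    have hk₂ : rC t₂ < n' := lt_of_lt_of_le (rankC_mem_of_lt_gen hCs hc hne hnT (mem_Ico.1 h₂'.1).1 (mem_Ico.1 h₂'.1).2).2 hnT
    have e₁ := closer_at hCs hc h₁'.2.1 hk₁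
    have e₂ := closer_at hCs hc h₂'.2.1 hk₂
    rw [← e₁, ← e₂, heq]

/-! ### Front-colour changes are boundary arrivals -/

include hCs in
/-- Between consecutive times the pop rank moves by at most one; a front-colour change needs a pop. [folklore] -/
theorem rankC_eq_succ_of_change {s : ℕ} (hs : 1 ≤ s) (hch : σ (o (rC s)) ≠ σ (o (rC (s - 1)))) :
    rC s = rC (s - 1) + 1 := by
  have h := hCs (s - 1)
  rw [Nat.sub_add_cancel hs] at h
  by_cases hW : W (s - 1) = true
  · rw [hW, if_pos rfl, add_zero] at h; exact absurd (by rw [h]) hch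
  · rw [if_neg hW] at h; exact h

include hCs hc in
/-- **The front colour changes at most `#boundaries inside alive(T)` times during `(T, gen T)`.** [folklore] -/
theorem card_changes_le_boundaries {T : ℕ} (hne : rC T < rO T) (hnT : rO T ≤ n') :
    changes σ rC o T (gen c rO T) ≤
      ((Ioo (rC T) (rO T)).filter fun k => σ (o k) ≠ σ (o (k - 1))).card := by
  classical
  unfold changes
  rw [← card_image_of_injOn (f := rC)]
  · refine card_le_card fun k hk => ?_
    rw [mem_image] at hk
    obtain ⟨s, hs, rfl⟩ := hk
    rw [mem_filter, mem_Ioo] at hs ⊢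
    obtain ⟨⟨hTs, hsG⟩, hch⟩ := hs
    have hstep := rankC_eq_succ_of_change hCs (by omega) hch
    have hprev : rC T ≤ rC (s - 1) := rankC_mono hCs (by omega)
    have hcur : rC s < rO T := (rankC_mem_of_lt_gen hCs hc hne hnT (le_of_lt hTs) hsG).2
    refine ⟨⟨by omega, hcur⟩, ?_⟩
    rw [hstep, Nat.add_sub_cancel]; rw [hstep] at hch; exact hch
  · intro s₁ h₁ s₂ h₂ heq
    have h₁' := mem_filter.1 (mem_coe.1 h₁); have h₂' := mem_filter.1 (mem_coe.1 h₂)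
    have e₁ := rankC_eq_succ_of_change hCs (σ := σ) (o := o) (by have := (mem_Ioo.1 h₁'.1).1; omega) h₁'.2
    have e₂ := rankC_eq_succ_of_change hCs (σ := σ) (o := o) (by have := (mem_Ioo.1 h₂'.1).1; omega) h₂'.2
    by_contra hne'
    rcases Nat.lt_or_gt_of_ne hne' with h | h
    · have := rankC_mono hCs (show s₁ ≤ s₂ - 1 by omega); omega
    · have := rankC_mono hCs (show s₂ ≤ s₁ - 1 by omega); omega

/-! ### Constant front colour between change times -/

/-- If no front-colour change time lies in `(u, v)`, the front colour on `[u, v)` is that of `u`. [folklore] -/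
theorem front_colour_const {u v : ℕ} (h0 : changes σ rC o u v = 0) {s : ℕ} (hus : u ≤ s) (hsv : s < v) :
    σ (o (rC s)) = σ (o (rC u)) := by
  classical
  unfold changes at h0
  rw [card_eq_zero, filter_eq_empty_iff] at h0
  induction s, hus using Nat.le_induction with
  | base => rfl
  | succ s hus ih =>
    have ih := ih (Nat.lt_of_succ_lt hsv)
    by_contra hne
    have hmem : s + 1 ∈ Ioo u v := mem_Ioo.2 ⟨Nat.lt_succ_of_le hus, hsv⟩
    exact h0 hmem (by rw [Nat.add_sub_cancel]; exact fun h => hne (h.trans ih))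

/-! ### The stretch sum (U3a): induction on the last change time -/

/-- `√((n+1)a) + √b ≤ √((n+2)(a+b))` (`n, a, b ≥ 0`): the Cauchy–Schwarz step of the stretch sum. [folklore] -/
theorem sqrt_succ_mul_add_sqrt_le {n a b : ℝ} (hn : 0 ≤ n) (ha : 0 ≤ a) (hb : 0 ≤ b) :
    Real.sqrt ((n + 1) * a) + Real.sqrt b ≤ Real.sqrt ((n + 2) * (a + b)) := by
  rw [Real.le_sqrt (by positivity) (by positivity)]
  have h1 : Real.sqrt ((n + 1) * a) ^ 2 = (n + 1) * a := Real.sq_sqrt (by positivity)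
  have h2 : Real.sqrt b ^ 2 = b := Real.sq_sqrt hb
  have h3 : Real.sqrt ((n + 1) * a) * Real.sqrt b = Real.sqrt a * Real.sqrt ((n + 1) * b) := by
    rw [← Real.sqrt_mul (by positivity), ← Real.sqrt_mul ha]; ring_nf
  have h4 : 2 * Real.sqrt a * Real.sqrt ((n + 1) * b) ≤ Real.sqrt a ^ 2 + Real.sqrt ((n + 1) * b) ^ 2 :=
    two_mul_le_add_sq _ _
  rw [Real.sq_sqrt ha, Real.sq_sqrt (by positivity)] at h4
  nlinarith [h1, h2, h3, h4]

/-- **One stretch.**  With no front-colour change inside `(u, v)`, the `b`-front S-pushes exceed the `b`-front S-pops by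
at most `C·√#fair[u,v)` (REG on one window, or both counts vanish). [folklore] -/
theorem stretch_base (b : Bool) {T G : ℕ} {C : ℝ} (hC : 0 ≤ C)
    (hreg : ∀ u v, T ≤ u → u ≤ v → v ≤ G →
      ((sPush W rO isR u v : ℝ) - sPop W rC isR u v) ≤ C * Real.sqrt (sPush W rO isR u v + sPop W rC isR u v))
    {u v : ℕ} (hTu : T ≤ u) (huv : u ≤ v) (hvG : v ≤ G) (h0 : changes σ rC o u v = 0) :
    ((bPush W σ rO rC o isR b u v : ℝ) - bPop W σ rC o isR b u v) ≤
      C * Real.sqrt (sPush W rO isR u v + sPop W rC isR u v) := by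
  classical
  by_cases hb : σ (o (rC u)) = b
  · -- constant front colour `b`: `b`-front counts are the plain counts
    have hP : bPush W σ rO rC o isR b u v = sPush W rO isR u v := by
      unfold bPush sPush
      congr 1
      refine filter_congr fun t ht => ?_
      rw [front_colour_const h0 (mem_Ico.1 ht).1 (mem_Ico.1 ht).2, hb]
      tauto
    have hQ : bPop W σ rC o isR b u v = sPop W rC isR u v := by
      unfold bPop sPop
      congr 1
      refine filter_congr fun t ht => ?_
      rw [front_colour_const h0 (mem_Ico.1 ht).1 (mem_Ico.1 ht).2, hb]
      tauto
    rw [hP, hQ]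
    exact hreg u v hTu huv hvG
  · -- constant front colour `≠ b`: both `b`-front counts vanish
    have hP : bPush W σ rO rC o isR b u v = 0 := by
      unfold bPush
      rw [card_eq_zero, filter_eq_empty_iff]
      intro t ht h
      rw [front_colour_const h0 (mem_Ico.1 ht).1 (mem_Ico.1 ht).2] at h
      exact hb h.2.2
    have hQ : bPop W σ rC o isR b u v = 0 := by
      unfold bPop
      rw [card_eq_zero, filter_eq_empty_iff]
      intro t ht h
      rw [front_colour_const h0 (mem_Ico.1 ht).1 (mem_Ico.1 ht).2] at h
      exact hb h.2.2
    rw [hP, hQ]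
    simp only [Nat.cast_zero, sub_zero]
    positivity

/-- **Stretch sum.**  If on every sub-window of `[T, G]` the S-pushes exceed the S-pops by at most `C·√#fair` (REG), then
on any `[u, v) ⊆ [T, G]` with at most `n` front-colour changes inside, the `b`-front S-pushes exceed the `b`-front S-pops by
at most `C·√((n+1)·#fair[u,v))` — induction on the LAST change time. [folklore] -/
theorem stretch_sum_le (b : Bool) {T G : ℕ} {C : ℝ} (hC : 0 ≤ C)
    (hreg : ∀ u v, T ≤ u → u ≤ v → v ≤ G →
      ((sPush W rO isR u v : ℝ) - sPop W rC isR u v) ≤ C * Real.sqrt (sPush W rO isR u v + sPop W rC isR u v)) :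
    ∀ n u v, T ≤ u → u ≤ v → v ≤ G → changes σ rC o u v ≤ n →
      ((bPush W σ rO rC o isR b u v : ℝ) - bPop W σ rC o isR b u v) ≤
        C * Real.sqrt ((n + 1) * (sPush W rO isR u v + sPop W rC isR u v)) := by
  classical
  intro n
  induction n with
  | zero =>
    intro u v hTu huv hvG hch
    have h := stretch_base (σ := σ) (o := o) b hC hreg hTu huv hvG (Nat.le_zero.1 hch)
    simpa using h
  | succ n ih =>
    intro u v hTu huv hvG hch
    by_cases hle : changes σ rC o u v ≤ n
    · refine (ih u v hTu huv hvG hle).trans ?_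
      apply mul_le_mul_of_nonneg_left _ hC
      apply Real.sqrt_le_sqrt
      apply mul_le_mul_of_nonneg_right _ (by positivity)
      push_cast; linarith
    · -- split at the LAST change time `d`
      have hpos : 0 < changes σ rC o u v := by omega
      set D := (Ioo u v).filter fun s => σ (o (rC s)) ≠ σ (o (rC (s - 1))) with hD
      have hDne : D.Nonempty := by
        rw [← card_pos]; unfold changes at hpos; exact hpos
      set d := D.max' hDne with hd
      have hdD : d ∈ D := max'_mem D hDne
      have hud : u < d := (mem_Ioo.1 (mem_filter.1 hdD).1).1
      have hdv : d < v := (mem_Ioo.1 (mem_filter.1 hdD).1).2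
      -- at most `n` changes in `(u, d)`, none in `(d, v)`
      have hch1 : changes σ rC o u d ≤ n := by
        have hsub : ((Ioo u d).filter fun s => σ (o (rC s)) ≠ σ (o (rC (s - 1)))) ⊆ D.erase d := by
          intro s hs
          rw [mem_filter, mem_Ioo] at hs
          rw [mem_erase, hD, mem_filter, mem_Ioo]
          exact ⟨ne_of_lt hs.1.2, ⟨hs.1.1, lt_trans hs.1.2 hdv⟩, hs.2⟩
        have h1 := card_le_card hsub
        rw [card_erase_of_mem hdD] at h1
        have h2 : D.card = changes σ rC o u v := rfl
        unfold changes
        omega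
      have hch2 : changes σ rC o d v = 0 := by
        unfold changes
        rw [card_eq_zero, filter_eq_empty_iff]
        intro s hs h
        have hsD : s ∈ D := by
          rw [hD, mem_filter, mem_Ioo]; rw [mem_Ioo] at hs
          exact ⟨⟨lt_trans hud hs.1, hs.2⟩, h⟩
        have := le_max' D s hsD
        rw [← hd] at this
        exact absurd (mem_Ioo.1 hs).1 (not_lt.2 this)
      have e1 := ih u d hTu (le_of_lt hud) ((le_of_lt hdv).trans hvG) hch1
      have e2 := stretch_base (σ := σ) (o := o) b hC hreg (hTu.trans (le_of_lt hud)) (le_of_lt hdv) hvG hch2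
      -- additivity at `d`
      have aP : (bPush W σ rO rC o isR b u v : ℝ) = bPush W σ rO rC o isR b u d + bPush W σ rO rC o isR b d v := by
        unfold bPush; exact_mod_cast card_filter_Ico_add _ (le_of_lt hud) (le_of_lt hdv)
      have aQ : (bPop W σ rC o isR b u v : ℝ) = bPop W σ rC o isR b u d + bPop W σ rC o isR b d v := by
        unfold bPop; exact_mod_cast card_filter_Ico_add _ (le_of_lt hud) (le_of_lt hdv)
      have aU : (sPush W rO isR u v : ℝ) = sPush W rO isR u d + sPush W rO isR d v := by
        unfold sPush; exact_mod_cast card_filter_Ico_add _ (le_of_lt hud) (le_of_lt hdv)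
      have aD : (sPop W rC isR u v : ℝ) = sPop W rC isR u d + sPop W rC isR d v := by
        unfold sPop; exact_mod_cast card_filter_Ico_add _ (le_of_lt hud) (le_of_lt hdv)
      set F₁ : ℝ := (sPush W rO isR u d : ℝ) + sPop W rC isR u d with hF₁
      set F₂ : ℝ := (sPush W rO isR d v : ℝ) + sPop W rC isR d v with hF₂
      have hsq := sqrt_succ_mul_add_sqrt_le (n := (n : ℝ)) (a := F₁) (b := F₂) (Nat.cast_nonneg n)
        (by positivity) (by positivity)
      have hrhs : C * Real.sqrt ((n + 1) * F₁) + C * Real.sqrt F₂ ≤ C * Real.sqrt (((n : ℝ) + 1 + 1) * (F₁ + F₂)) := by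
        rw [← mul_add]
        apply mul_le_mul_of_nonneg_left _ hC
        refine hsq.trans (le_of_eq ?_)
        congr 1; ring
      rw [aP, aQ, aU, aD]
      push_cast
      have hF : (sPush W rO isR u d : ℝ) + sPush W rO isR d v + (sPop W rC isR u d + sPop W rC isR d v) = F₁ + F₂ := by
        rw [hF₁, hF₂]; ring
      rw [hF]
      linarith [e1, e2, hrhs]

/-! ### The growth bound of one generation -/

include hOs hCs ho hc in
/-- **Growth bound (U3).**  Over one generation `[T, gen T)`: the alive `b`-S-items at `gen T` are at most those at `T`,
plus the tests of the generation, plus `C·√((#boundaries inside alive(T) + 1)·#fair)` — the only non-test source of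
new `b`-S-items being S-pushes copying a `b`-front, priced stretch by stretch by REG. [folklore] -/
theorem growth_le (b : Bool) {T : ℕ} (hne : rC T < rO T) (hnT : rO T ≤ n') (hnG : rO (gen c rO T) ≤ n')
    {C : ℝ} (hC : 0 ≤ C)
    (hreg : ∀ u v, T ≤ u → u ≤ v → v ≤ gen c rO T →
      ((sPush W rO isR u v : ℝ) - sPop W rC isR u v) ≤ C * Real.sqrt (sPush W rO isR u v + sPop W rC isR u v)) :
    (aliveS σ rO rC o isR b (gen c rO T) : ℝ) ≤ aliveS σ rO rC o isR b T + sTests W σ rO rC o isR T (gen c rO T) +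
      C * Real.sqrt ((((Ioo (rC T) (rO T)).filter fun k => σ (o k) ≠ σ (o (k - 1))).card + 1) *
        (sPush W rO isR T (gen c rO T) + sPop W rC isR T (gen c rO T))) := by
  classical
  set G := gen c rO T with hG
  have hTG : T < G := lt_gen hc hne hnT
  have hpush_n : ∀ t, T ≤ t → t < G → W t = true → rO t < n' := fun t _ ht hW => by
    have h1 : rO (t + 1) ≤ rO G := rankO_mono hOs (Nat.succ_le_of_lt ht)
    rw [hOs, if_pos hW] at h1; omega
  have h1 : (aliveS σ rO rC o isR b G : ℝ) ≤ sTests W σ rO rC o isR T G + bPush W σ rO rC o isR b T G := by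
    rw [card_aliveS_gen_eq hOs hCs ho hc b hne hnT hnG]
    exact_mod_cast card_bPush_le hOs ho b hpush_n
  have h2 := stretch_sum_le (σ := σ) (o := o) b hC hreg (changes σ rC o T G) T G le_rfl (le_of_lt hTG) le_rfl le_rfl
  have h3 : (bPop W σ rC o isR b T G : ℝ) ≤ aliveS σ rO rC o isR b T := by
    exact_mod_cast card_bPop_le_aliveS hCs hc b hne hnT
  have h4 : C * Real.sqrt ((changes σ rC o T G + 1 : ℝ) * (sPush W rO isR T G + sPop W rC isR T G)) ≤
      C * Real.sqrt ((((Ioo (rC T) (rO T)).filter fun k => σ (o k) ≠ σ (o (k - 1))).card + 1 : ℝ) *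
        (sPush W rO isR T G + sPop W rC isR T G)) := by
    apply mul_le_mul_of_nonneg_left _ hC
    apply Real.sqrt_le_sqrt
    apply mul_le_mul_of_nonneg_right _ (by positivity)
    exact_mod_cast Nat.add_le_add_right (card_changes_le_boundaries hCs hc hne hnT) 1
  linarith [h1, h2, h3, h4]

end AbstractQueue

end Summit.ValiantsHypothesis.ValiantsHypothesis.Theorems.FifoMatching.NNLinearDegreeCofactorHard.QueueHistory
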